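import Summits.ABC.IUTFork.Cor312HullGainRamifiedAllLabels
import Summits.ABC.IUTFork.Cor312RegimeVerbatimPrVolExactPositive
import HarnessLib

/-!
# R-J census, row Y-21ℓ — the ramified hull gain made QUANTITATIVE, I: at a place of ramification index `e ≥ 2` the typed
# (Ind1)/(Ind2)-hull exceeds the (Ind3)-region at label `i+1` by at least `Pr(v,…,v)·((i+1)(e−1)/e)·log p`

Proof-only record file of the abc-iut cell, branch E → R-J «Joshi Y-discharge census» (D-0079; rung LADDER-ABC:A2.RESCUE.J; seat
abc-iut-E-t59, gen 9; sequel of this seat's p463394 `TestATS4LowerBoundGenuineConverse` / p464724 `…ConverseWitness`, whose HONEST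
SCOPE left open the window question for `q`-ideles REALISING `P_q` — undecided in the tree without a QUANTITATIVE form of
abc-iut-c312-5's ramified hull gain). **No side is taken** on [IUTchIII] Cor. 3.12 / [IUTchIV] Thm 1.10 or on any author;
typed ≠ proved ≠ endorsed; no definition, no `Prop` fact, no instance.

abc-iut-c312-5's `Cor312HullGainRamifiedAllLabels` (p443796) proves `μ^log((Ind3)-region_{i+1,p}) < −|log(Θ)|_{i+1,p}` at every
place `v | p` with `e_v ≥ 2`, by moving the point `p^k·z^{⊗(i+2)}` of the Θ-box with the (Ind2)-mover of `Cor312HullGainMover`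
(`‖g z‖ ≥ p^{(e−1)/e}·‖z‖`) for SOME admissible `k`. THIS FILE chooses `k` OPTIMALLY (Euclidean division of the value-group
exponents by `e`, §0) and reads off the size of the gain: **`logvol_thetaRegion3_add_gain_le_thetaLocal_settingPrVolSharp`** — for
arbitrary non-zero pilot ideles (units off `S`), every prime `p`, every label `i+1` and every place `v | p` with `e := e_v ≥ 2`,
`μ^log_{Pr}((Ind3)-region_{i+1,p}) + Pr(v,…,v)·((i+1)(e−1)/e)·log p ≤ −|log(Θ)|_{i+1,p}` (the hull radii on the diagonal summand
`(v,…,v)` are `≥ ‖t_{Θ,i+1,v}‖·p^{(i+1)(e−1)/e}`; all other radii dominate the box radii; `Σ_j e_j f_j / deg = 1`). The sequel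
`TestATS4HullGainQuantitativeTrivial` specialises to the trivial ideles `𝟙`: `((e−1)/e)·((ℓ⋆+1)/2)·log p ≤ −|log(Θ)|(𝟙)` when `v` is
the only place over `p` — an explicit lower bound on the length of p463394's inflation window `(0, −|log(Θ)|(𝟙)]`.
HONEST SCOPE: Dupuy–Hilado's (Ind2) as typed at the real setting (`Real.ismDH`: all shell-preserving lattice automorphisms — under a
smaller Ism the movers may be absent); sharp (Ind3) reading; trivial archimedean container; nothing asserted about [IUTchIII]
Cor. 3.12 for initial Θ-data. [cite: DupuyHilado2025, §3.6, §3.9, §4.9] [cite: NeukirchANT1999, Ch. II Prop. (5.5), Prop. (6.8)]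
[cite: Mochizuki2012, IUTchIV Thm 1.10 proof Step (v) p. 27–28] [claim: Mochizuki2012, status: disputed]. Standard axioms.
-/

noncomputable section

open Set Function NumberField IsDedekindDomain Metric
open scoped Pointwise

namespace Summit.ABC.IUTFork.Joshi

open Thm311 Thm311.Real Cor312 Cor312.Setting Cor312Vol Literature.IUT.LogThetaLattice Literature.IUT.LogVolume
  Literature.NumberTheory.NumberFields

namespace TestATS4HullGain

variable {F : Type} [Field F] [NumberField F] (X : PilotData F) {logv : PadicLogs F} (hlog : LogvAnalytic logv)

variable (M : Type) [Field M] [NumberField M]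
  (archPk : ∀ (j : (thetaIndex X).Label) (vQ : (thetaIndex X).VQ), Set ((logShellsDH X logv).Packet j vQ))
  (archSub : ∀ (j : (thetaIndex X).Label) (v : (thetaIndex X).V),
    Set ((logShellsDH X logv).Packet j ((thetaIndex X).over v)))
  (Ψ : ℤ → ∀ v : (thetaIndex X).V, v ∈ (thetaIndex X).Vbad → Set ((logShellsDH X logv).StarPacket v))
  (act : ℤ → ∀ v : (thetaIndex X).V, v ∈ (thetaIndex X).Vbad →
    (logShellsDH X logv).StarPacket v → Module.End ℚ ((logShellsDH X logv).StarPacket v))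
  (Mmod : ℤ → ∀ j : (thetaIndex X).LabelStar, Set ((logShellsDH X logv).GlobalPacket j.1))
  (region : ℤ → ∀ j : (thetaIndex X).LabelStar, FinDivisor M → ∀ vQ : (thetaIndex X).VQ,
    Set ((logShellsDH X logv).Packet j.1 vQ))
  (n : ℤ)
  (t : ∀ (pp : Nat.Primes) (_ : Fin X.lstar) (x : (thetaIndex X).Fibre (.inr pp)),
    haveI : Fact (pp : ℕ).Prime := ⟨pp.2⟩; kOf X pp.1 x)
  (tq : ∀ (pp : Nat.Primes) (x : (thetaIndex X).Fibre (.inr pp)),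
    haveI : Fact (pp : ℕ).Prime := ⟨pp.2⟩; kOf X pp.1 x)
  {HT : Type} {LogLink : HT → HT → Type} {IsFull : ∀ {s t : HT}, LogLink s t → Prop}
  (lat : LGPGaussianLogThetaLattice LogLink IsFull)
  {Frd : Type} {IsoF : Frd → Frd → Type} {Ob : Frd → Type} {realify : Frd → Frd} {Strip : Type}
  {IsoS : Strip → Strip → Type} {Mv : ∀ v : (thetaIndex X).V, v ∈ (thetaIndex X).Vbad → Type}
  [∀ v h, Monoid (Mv v h)]
  (sig : GlobalLGPFrobenioidSignature (thetaIndex X).lstar (thetaIndex X).V (· ∈ (thetaIndex X).Vbad)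
    Frd IsoF Ob realify Strip IsoS Mv)
  (split : SplittingMonoids Mv) {ObΔ : Type} {N : ∀ v : (thetaIndex X).V, v ∈ (thetaIndex X).Vbad → Type}
  [∀ v h, Monoid (N v h)] (qData : QPilotData ObΔ N)

/-! ## 0. Arithmetic of the optimal `p`-power -/

/-- **Optimal `p`-power, integer form**: for integers `a, b, c`, a natural `N` and `e ≥ 1` with `b + (e − 1) ≤ a`, the
quotient `q := ⌊(N·a − c)/e⌋` satisfies `e·q ≤ N·a − c` and `(N − 1)(e − 1) − c ≤ e·q − N·b` (Euclidean division:
`N·a − c = e·q + r`, `0 ≤ r ≤ e − 1`, and `N·b ≤ N·a − N(e−1)`). [folklore] -/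
theorem ediv_window (a b c : ℤ) (N e : ℕ) (he : 0 < e) (hba : b + ((e : ℤ) - 1) ≤ a) :
    (e : ℤ) * (((N : ℤ) * a - c) / e) ≤ (N : ℤ) * a - c ∧
      ((N : ℤ) - 1) * ((e : ℤ) - 1) - c ≤ (e : ℤ) * (((N : ℤ) * a - c) / e) - (N : ℤ) * b := by
  have he0 : (e : ℤ) ≠ 0 := by exact_mod_cast he.ne'
  have hdiv := Int.mul_ediv_add_emod ((N : ℤ) * a - c) e
  have hr0 := Int.emod_nonneg ((N : ℤ) * a - c) he0
  have hre := Int.emod_lt_of_pos ((N : ℤ) * a - c) (show (0 : ℤ) < e by exact_mod_cast he)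
  refine ⟨by linarith, ?_⟩
  have hN : (0 : ℤ) ≤ N := Int.natCast_nonneg N
  nlinarith

/-- **Splitting off one summand**: if `A ≤ C` termwise on `s` and `A(a) + W ≤ C(a)` at some `a ∈ s`, then
`Σ_s A + W ≤ Σ_s C`. [folklore] -/
theorem sum_add_le_sum_of_le_of_add_le {ι : Type*} {s : Finset ι} {A C : ι → ℝ} {a : ι} {W : ℝ} (ha : a ∈ s)
    (hAC : ∀ e ∈ s, A e ≤ C e) (hd : A a + W ≤ C a) : ∑ e ∈ s, A e + W ≤ ∑ e ∈ s, C e := by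
  have h1 : W ≤ ∑ e ∈ s, (C e - A e) :=
    le_trans (by linarith) (Finset.single_le_sum (f := fun e => C e - A e) (fun e he => sub_nonneg.mpr (hAC e he)) ha)
  rw [Finset.sum_sub_distrib] at h1
  linarith

/-! ## 1. The quantitative gain at a ramified packet, arbitrary Θ-ideles -/

/-- **QUANTITATIVE ramified hull gain, every label.** At abc-iut-c312-7's `Real.settingPrVolSharp` with arbitrary non-zero pilot
ideles (units off `S`), for every prime `p`, every label `i+1 ∈ 𝔽_l^⋇` and every place `v | p` of `F` with `e := e_v ≥ 2`:
**`μ^log_{Pr}((Ind3)-region_{i+1,p}) + Pr(v,…,v)·((i+1)·(e−1)/e)·log p ≤ −|log(Θ)|_{i+1,p}`**. abc-iut-c312-5's mover (`Cor312HullGainMover`: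
`g ∈ Real.ismDH` at `v` with `‖g z‖ ≥ p^{(e−1)/e}‖z‖`) carries the point `p^k·z^{⊗(i+2)}` of the Θ-box, with `k` chosen by Euclidean
division of the value-group exponents (§0), to a possible image whose coordinates in every field factor of the diagonal summand
`F_v^{⊗(i+2)}` have norm `≥ ‖t_{Θ,i+1,v}‖·p^{(i+1)(e−1)/e}`; the hull is a hull-set containing the box centre and that image, and its
probability-weighted log-volume (abc-iut-w4-d036 `sum_w_packetLogμ_factorMap_preimage_hullSet`, `Σ_j e_j f_j = deg`) exceeds the
region's by at least the displayed amount. Quantitative form of p443796 `logvol_thetaRegion3_lt_thetaLocal_…`.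
[cite: DupuyHilado2025, §3.6, §3.9, §4.9] [cite: NeukirchANT1999, Ch. II Prop. (5.5)] [claim: Mochizuki2012, status: disputed] -/
theorem logvol_thetaRegion3_add_gain_le_thetaLocal_settingPrVolSharp (ht0 : ∀ pp i x, t pp i x ≠ 0)
    (ht1 : ∀ (pp : Nat.Primes) (i : Fin X.lstar) (x : (thetaIndex X).Fibre (.inr pp)),
      haveI : Fact (pp : ℕ).Prime := ⟨pp.2⟩; placeOf X pp.1 x ∉ X.S → ‖t pp i x‖ = 1)
    (htq0 : ∀ pp x, tq pp x ≠ 0)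
    (htq1 : ∀ (pp : Nat.Primes) (x : (thetaIndex X).Fibre (.inr pp)),
      haveI : Fact (pp : ℕ).Prime := ⟨pp.2⟩; placeOf X pp.1 x ∉ X.S → ‖tq pp x‖ = 1)
    (i : Fin (thetaIndex X).lstar) (pp : Nat.Primes) [Fact (pp : ℕ).Prime]
    (v : HeightOneSpectrum (𝓞 F)) (hv : (thetaIndex X).over (.inr v) = .inr pp)
    (hvp : ((pp : ℕ) : 𝓞 F) ∈ v.asIdeal) (he : 2 ≤ absRamificationIdx (pp : ℕ) (RescaledCompletion F (pp : ℕ) v hvp)) :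
    ((((situationPrVol X hlog M archPk archSub Ψ act Mmod region).D n).logvol (Setting.labelSucc i) (.inr pp)
        ((settingPrVolSharp X hlog M archPk archSub Ψ act Mmod region n lat sig split qData tq t htq0
          htq1).thetaRegion3 (Setting.labelSucc i) (.inr pp)) +
        weightPr X pp.1 (Setting.labelSucc i) (fun _ => ⟨.inr v, hv⟩) *
          ((((i : ℕ) : ℝ) + 1) * ((absRamificationIdx (pp : ℕ) (RescaledCompletion F (pp : ℕ) v hvp) : ℝ) - 1) /
            (absRamificationIdx (pp : ℕ) (RescaledCompletion F (pp : ℕ) v hvp) : ℝ) * Real.log (pp : ℕ)) : ℝ) :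
          WithTop ℝ) ≤
      (settingPrVolSharp X hlog M archPk archSub Ψ act Mmod region n lat sig split qData tq t htq0
        htq1).thetaLocal (Setting.labelSucc i) (.inr pp) := by
  classical
  have hp1 : (1 : ℝ) < (pp : ℕ) := by exact_mod_cast pp.2.one_lt
  have hp0 : (0 : ℝ) < (pp : ℕ) := zero_lt_one.trans hp1
  set e : ℕ := absRamificationIdx (pp : ℕ) (RescaledCompletion F (pp : ℕ) v hvp) with hedef
  have he0 : 0 < e := lt_of_lt_of_le two_pos he
  have heR : (0 : ℝ) < e := by exact_mod_cast he0
  set x₀ : (thetaIndex X).Fibre (.inr pp) := ⟨.inr v, hv⟩ with hx₀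
  set Ncap : ℕ := Fintype.card ((thetaIndex X).Caps (Setting.labelSucc i)) with hNcap
  have hNcap_eq : Ncap = (i : ℕ) + 2 := by
    show Fintype.card (Fin (((Fin.succ i : Fin (X.lstar + 1)) : ℕ) + 1)) = _
    rw [Fintype.card_fin, Fin.val_succ]
  set e₀ : (thetaIndex X).Caps (Setting.labelSucc i) → (thetaIndex X).Fibre (.inr pp) := fun _ => x₀ with he₀
  set Pset := settingPrVolSharp X hlog M archPk archSub Ψ act Mmod region n lat sig split qData tq t htq0 htq1
    with hPset
  haveI : Nonempty ((thetaIndex X).Caps (Setting.labelSucc i)) := ⟨0⟩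
  -- the box radius at the diagonal summand: `τ = ‖t_{Θ,i+1,v}‖ = p^{-c/e}`
  obtain ⟨c, hc⟩ := exists_norm_eq_rpow (pp : ℕ) (kOf X pp.1 x₀) (ht0 pp i x₀)
  change ‖t pp i x₀‖ = ((pp : ℕ) : ℝ) ^ (-((c : ℝ) / (e : ℝ))) at hc
  -- §1: the mover at `v` and the value-group exponents of `z`, `g z`
  obtain ⟨g, hg, g', hgg', z, hz0, hzexp⟩ := exists_mem_ismDH_rpow_mul_norm_le X hlog pp v hv hvp
  obtain ⟨a, ha⟩ := exists_norm_eq_rpow (pp : ℕ) ((presAt X hlog pp).k x₀) hz0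
  change ‖z‖ = ((pp : ℕ) : ℝ) ^ (-((a : ℝ) / (e : ℝ))) at ha
  have hgz0 : g' z ≠ 0 := fun h0 => by
    rw [h0, norm_zero] at hzexp; exact not_lt.mpr hzexp (mul_pos (Real.rpow_pos_of_pos hp0 _) (norm_pos_iff.mpr hz0))
  obtain ⟨b, hb⟩ := exists_norm_eq_rpow (pp : ℕ) ((presAt X hlog pp).k x₀) hgz0
  change ‖g' z‖ = ((pp : ℕ) : ℝ) ^ (-((b : ℝ) / (e : ℝ))) at hb
  have hba : b + ((e : ℤ) - 1) ≤ a := by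
    rw [ha, hb, ← Real.rpow_add hp0, Real.rpow_le_rpow_left_iff hp1] at hzexp
    have h : ((e : ℝ) - 1) + -(a : ℝ) ≤ -(b : ℝ) := by
      have h1 := mul_le_mul_of_nonneg_right hzexp heR.le
      rwa [show (((e : ℝ) - 1) / (e : ℝ) + -((a : ℝ) / (e : ℝ))) * (e : ℝ) = ((e : ℝ) - 1) + -(a : ℝ) by field_simp,
        show -((b : ℝ) / (e : ℝ)) * (e : ℝ) = -(b : ℝ) by field_simp] at h1
    have h' : (b : ℝ) + ((e : ℝ) - 1) ≤ a := by linarith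
    exact_mod_cast h'
  -- the optimal `p`-power `k := -⌊(N a − c)/e⌋`
  obtain ⟨hq1, hq2⟩ := ediv_window a b c Ncap e he0 hba
  set q : ℤ := ((Ncap : ℤ) * a - c) / e with hqdef
  set k : ℤ := -q with hkdef
  have hnk : ‖((pp : ℕ) : ℚ_[pp]) ^ k‖ = ((pp : ℕ) : ℝ) ^ (q : ℝ) := by
    rw [norm_zpow, Padic.norm_p, inv_zpow', hkdef, neg_neg, Real.rpow_intCast]
  have hzN : ‖z‖ ^ Ncap = ((pp : ℕ) : ℝ) ^ (-((a : ℝ) / (e : ℝ)) * Ncap) := by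
    rw [ha, ← Real.rpow_natCast, ← Real.rpow_mul hp0.le]
  have hgzN : ‖g' z‖ ^ Ncap = ((pp : ℕ) : ℝ) ^ (-((b : ℝ) / (e : ℝ)) * Ncap) := by
    rw [hb, ← Real.rpow_natCast, ← Real.rpow_mul hp0.le]
  set ρ : ℝ := ((pp : ℕ) : ℝ) ^ (q : ℝ) * ‖g' z‖ ^ Ncap with hρ
  have hρ_eq : ρ = ((pp : ℕ) : ℝ) ^ (((e : ℝ) * q - (Ncap : ℝ) * b) / (e : ℝ)) := by
    rw [hρ, hgzN, ← Real.rpow_add hp0]; congr 1; field_simp; ring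
  have hρ_pos : 0 < ρ := by rw [hρ_eq]; exact Real.rpow_pos_of_pos hp0 _
  -- the box condition: `p^{q}·‖z‖^N ≤ τ`
  have hbox : ((pp : ℕ) : ℝ) ^ (q : ℝ) * ‖z‖ ^ Ncap ≤ ‖t pp i x₀‖ := by
    rw [hzN, ← Real.rpow_add hp0, hc]
    refine Real.rpow_le_rpow_of_exponent_le hp1.le ?_
    have h1 : ((e : ℤ) : ℝ) * (q : ℝ) ≤ (Ncap : ℝ) * (a : ℝ) - (c : ℝ) := by exact_mod_cast hq1
    rw [show (q : ℝ) + -((a : ℝ) / (e : ℝ)) * (Ncap : ℝ) = ((e : ℝ) * q - (Ncap : ℝ) * a) / (e : ℝ) by field_simp; ring,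
      div_le_iff₀ heR, show -((c : ℝ) / (e : ℝ)) * (e : ℝ) = -(c : ℝ) by field_simp]
    push_cast at h1
    linarith
  -- the gain: `log ρ ≥ log τ + ((N−1)(e−1)/e)·log p`
  have hgain : Real.log ‖t pp i x₀‖ + (((i : ℕ) : ℝ) + 1) * ((e : ℝ) - 1) / (e : ℝ) * Real.log (pp : ℕ) ≤ Real.log ρ := by
    rw [hρ_eq, hc, Real.log_rpow hp0, Real.log_rpow hp0, ← add_mul]
    refine mul_le_mul_of_nonneg_right ?_ (Real.log_nonneg hp1.le)
    have h2 : (((Ncap : ℤ) : ℝ) - 1) * (((e : ℤ) : ℝ) - 1) - (c : ℝ) ≤ ((e : ℤ) : ℝ) * (q : ℝ) - ((Ncap : ℤ) : ℝ) * (b : ℝ) := by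
      exact_mod_cast hq2
    have hN' : (Ncap : ℝ) = (i : ℝ) + 2 := by exact_mod_cast hNcap_eq
    push_cast at h2
    rw [← neg_div, ← add_div, div_le_div_iff_of_pos_right heR]
    rw [hN'] at h2 ⊢
    linarith
  -- §2a: the (Ind2)-family acting by `g` at `v` (every slot) and trivially elsewhere
  set G : ∀ y : Thm311.Real.Place F, Thm311.Real.Carrier y ≃ₗ[ℚ] Thm311.Real.Carrier y :=
    Function.update (fun y => LinearEquiv.refl ℚ (Thm311.Real.Carrier y)) (.inr v) g with hG
  have hGv : G (.inr v) = g := by rw [hG, Function.update_self]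
  have hGmem : ∀ y : Thm311.Real.Place F, G y ∈ ismDH logv y := by
    intro y; by_cases hy : y = .inr v
    · subst hy; rw [hGv]; exact hg
    · rw [hG, Function.update_of_ne hy]; exact refl_mem_ismDH logv y
  choose g'' hg'' using fun w : (thetaIndex X).Fibre (.inr pp) => (presAt X hlog pp).ism_linear w (G w.1) (hGmem w.1)
  set Φ : (logShellsDH X logv).PacketAut := fun j' vQ' =>
    (logShellsDH X logv).factorwise j' vQ' fun _ => (logShellsDH X logv).summandwise vQ' fun w => G w.1 with hΦ
  have hΦ2 : Φ ∈ (logShellsDH X logv).Ind2Family := fun j' vQ' => ⟨fun _ w => G w.1, fun _ w => hGmem w.1, rfl⟩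
  have hΦind : Φ ∈ Setting.indGroup (situationPrVol X hlog M archPk archSub Ψ act Mmod region) :=
    Subgroup.subset_closure (Or.inr hΦ2)
  have hcomp : ∀ x, (presAt X hlog pp).comparison (Setting.labelSucc i) (Φ (Setting.labelSucc i) (.inr pp) x) =
      fun e => (PiTensorProduct.congr fun a => g'' (e a) : (presAt X hlog pp).X e ≃ₗ[ℚ_[pp]] (presAt X hlog pp).X e)
        ((presAt X hlog pp).comparison (Setting.labelSucc i) x e) :=
    fun x => (presAt X hlog pp).comparison_factorwise (fun _ w => G w.1) (fun _ w => g'' w) (fun _ w y => hg'' w y) x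
  have hGx : ∀ y, G x₀.1 y = g y := fun y => by change G (.inr v) y = g y; rw [hGv]
  have hagree : ∀ u, g'' x₀ u = g' u := by
    intro u
    obtain ⟨y, rfl⟩ := ((presAt X hlog pp).φ x₀).surjective u
    rw [← hg'' x₀ y, ← hgg' y]
    exact congrArg _ (hGx y)
  -- §2b: the point `w = p^k·z^{⊗N}` of the box and its image
  set u : (presAt X hlog pp).X e₀ := purePacket (pp : ℕ) ((presAt X hlog pp).kk e₀) fun _ => z with hu
  set w : (presAt X hlog pp).X e₀ := (((pp : ℕ) : ℚ_[pp]) ^ k) • u with hw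
  have hnorm_u : ∀ jj : DIdx (pp : ℕ) ((presAt X hlog pp).kk e₀), ‖dEquiv (pp : ℕ) ((presAt X hlog pp).kk e₀) u jj‖ =
      ‖z‖ ^ Ncap := by
    intro jj
    rw [hu, psi_purePacket_apply (pp : ℕ) ((presAt X hlog pp).kk e₀) (DFac (pp : ℕ) ((presAt X hlog pp).kk e₀))
      (dEquiv (pp : ℕ) ((presAt X hlog pp).kk e₀)), norm_prod]
    exact Finset.prod_eq_pow_card fun a _ =>
      norm_factorEmb (pp : ℕ) ((presAt X hlog pp).kk e₀) (DFac (pp : ℕ) ((presAt X hlog pp).kk e₀))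
        (dEquiv (pp : ℕ) ((presAt X hlog pp).kk e₀)) a jj _
  have hnorm_w : ∀ jj : DIdx (pp : ℕ) ((presAt X hlog pp).kk e₀), ‖dEquiv (pp : ℕ) ((presAt X hlog pp).kk e₀) w jj‖ =
      ((pp : ℕ) : ℝ) ^ (q : ℝ) * ‖z‖ ^ Ncap := by
    intro jj
    rw [hw, map_smul, Pi.smul_apply, norm_smul, hnk, hnorm_u]
  have hgu : (PiTensorProduct.congr fun a => g'' (e₀ a) :
        (presAt X hlog pp).X e₀ ≃ₗ[ℚ_[pp]] (presAt X hlog pp).X e₀) u =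
      purePacket (pp : ℕ) ((presAt X hlog pp).kk e₀) fun _ => g' z := by
    rw [hu, purePacket, purePacket, PiTensorProduct.congr_tprod]
    exact congrArg _ (funext fun a => hagree z)
  have hnorm_gw : ∀ jj : DIdx (pp : ℕ) ((presAt X hlog pp).kk e₀),
      ‖dEquiv (pp : ℕ) ((presAt X hlog pp).kk e₀) ((PiTensorProduct.congr fun a => g'' (e₀ a) :
        (presAt X hlog pp).X e₀ ≃ₗ[ℚ_[pp]] (presAt X hlog pp).X e₀) w) jj‖ = ρ := by
    intro jj
    rw [hw, map_smul, hgu, map_smul, Pi.smul_apply, norm_smul, hnk,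
      psi_purePacket_apply (pp : ℕ) ((presAt X hlog pp).kk e₀) (DFac (pp : ℕ) ((presAt X hlog pp).kk e₀))
        (dEquiv (pp : ℕ) ((presAt X hlog pp).kk e₀)), norm_prod, hρ]
    exact congrArg _ (Finset.prod_eq_pow_card fun a _ =>
      norm_factorEmb (pp : ℕ) ((presAt X hlog pp).kk e₀) (DFac (pp : ℕ) ((presAt X hlog pp).kk e₀))
        (dEquiv (pp : ℕ) ((presAt X hlog pp).kk e₀)) a jj _)
  -- §2c: the (Ind3)-region at `(i+1, p)` is the hull-set with the Θ-centre `c₀`, `‖c₀_{(v⃗,j)}‖ = ‖t_{Θ,i+1,v_{i+1}}‖`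
  obtain ⟨c₀, hc₀⟩ : ∃ c₀ : ∀ s : (presAt X hlog pp).factorIdx (Setting.labelSucc i),
      (presAt X hlog pp).factorField (Setting.labelSucc i) s,
      c₀ = (presAt X hlog pp).centreOf fun e => iota pp.1 ((presAt X hlog pp).kk e) (Fin.last _)
        (labelIdele X t pp (Setting.labelSucc i) (e (Fin.last _))) := ⟨_, rfl⟩
  have hc₀norm : ∀ (e : (thetaIndex X).Caps (Setting.labelSucc i) → (thetaIndex X).Fibre (.inr pp))
      (jj : DIdx (pp : ℕ) ((presAt X hlog pp).kk e)), ‖c₀ ⟨e, jj⟩‖ = ‖t pp i (e (Fin.last _))‖ := by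
    intro e jj; rw [hc₀, norm_thetaCentre_sharp, labelIdele_labelSucc]
  have hc₀ne : ∀ s, c₀ s ≠ 0 := by rw [hc₀]; exact thetaCentre_sharp_ne_zero X hlog t ht0 pp (Setting.labelSucc i)
  have h3 : Pset.thetaRegion3 (Setting.labelSucc i) (.inr pp) =
      (fun x => (presAt X hlog pp).factorMap (Setting.labelSucc i) x) ⁻¹'
        hullSet ((presAt X hlog pp).factorField (Setting.labelSucc i)) c₀ := by
    rw [hPset, settingPrVolSharp, thetaRegion3_settingPrVol, iUnion_thetaBoxDH_sharp, thetaBoxDH_sharp_inr X hlog t ht0,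
      hc₀]
    rfl
  have hmem3 : ∀ y : (logShellsDH X logv).Packet (Setting.labelSucc i) (.inr pp),
      y ∈ Pset.thetaRegion3 (Setting.labelSucc i) (.inr pp) ↔ ∀ e jj,
        ‖dEquiv (pp : ℕ) ((presAt X hlog pp).kk e) ((presAt X hlog pp).comparison (Setting.labelSucc i) y e) jj‖ ≤
          ‖c₀ ⟨e, jj⟩‖ := by
    intro y
    rw [h3]
    change (presAt X hlog pp).factorMap (Setting.labelSucc i) y ∈
      hullSet ((presAt X hlog pp).factorField (Setting.labelSucc i)) c₀ ↔ _
    rw [hullSet, mem_polydisc]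
    exact ⟨fun h e jj => h ⟨e, jj⟩, fun h s => h s.1 s.2⟩
  obtain ⟨x, hx⟩ := (presAt X hlog pp).comparison_surjective (Setting.labelSucc i) (Pi.single e₀ w)
  have hx3 : x ∈ Pset.thetaRegion3 (Setting.labelSucc i) (.inr pp) := by
    refine (hmem3 x).mpr fun e jj => ?_
    rw [hx]
    by_cases hee : e = e₀
    · subst hee
      rw [Pi.single_eq_same, hnorm_w, hc₀norm]
      exact hbox
    · rw [Pi.single_eq_of_ne hee, map_zero, Pi.zero_apply, norm_zero]
      exact norm_nonneg _
  -- the CENTRE point of the box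
  obtain ⟨x₁, hx₁⟩ := (presAt X hlog pp).comparison_surjective (Setting.labelSucc i)
    (fun e => (dEquiv (pp : ℕ) ((presAt X hlog pp).kk e)).symm fun jj => c₀ ⟨e, jj⟩)
  have hx₁3 : x₁ ∈ Pset.thetaRegion3 (Setting.labelSucc i) (.inr pp) := by
    refine (hmem3 x₁).mpr fun e jj => ?_
    simp only [hx₁, AlgEquiv.apply_symm_apply, le_refl]
  -- §2d: the hull is a hull-set `e⁻¹(λ·𝒪_L)` containing both points
  have hHD := hullDefined_settingPrVolSharp X hlog M archPk archSub Ψ act Mmod region n t tq lat sig split qData ht0 ht1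
    htq0 htq1 i (.inr pp)
  have hmemHul : Pset.thetaHull (Setting.labelSucc i) (.inr pp) ∈
      ((HullFrame.ofLocalFields (factorFieldDH X hlog (Setting.labelSucc i) (.inr pp))).comap
        (factorMapDH X hlog (Setting.labelSucc i) (.inr pp))).Hul :=
    (Pset.frame (Setting.labelSucc i) (.inr pp)).hull_mem_of_hasHull hHD.1 hHD.2
  obtain ⟨H', ⟨cH, hcH0, rfl⟩, hEq⟩ := hmemHul
  have hsub : ⋃₀ Pset.possibleImages (Setting.labelSucc i) (.inr pp) ⊆ Pset.thetaHull (Setting.labelSucc i) (.inr pp) :=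
    (Pset.frame (Setting.labelSucc i) (.inr pp)).subset_hull _
  have hmemc : ∀ y ∈ Pset.thetaHull (Setting.labelSucc i) (.inr pp), ∀ e jj,
      ‖dEquiv (pp : ℕ) ((presAt X hlog pp).kk e) ((presAt X hlog pp).comparison (Setting.labelSucc i) y e) jj‖ ≤
        ‖cH ⟨e, jj⟩‖ := by
    intro y hy e jj
    rw [hEq] at hy
    change factorMapDH X hlog (Setting.labelSucc i) (.inr pp) y ∈
      hullSet (factorFieldDH X hlog (Setting.labelSucc i) (.inr pp)) cH at hy
    rw [hullSet, mem_polydisc] at hy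
    exact hy ⟨e, jj⟩
  -- the centre point: every radius of the hull dominates the box radius
  have hc1 : ∀ (e : (thetaIndex X).Caps (Setting.labelSucc i) → (thetaIndex X).Fibre (.inr pp))
      (jj : DIdx (pp : ℕ) ((presAt X hlog pp).kk e)), ‖c₀ ⟨e, jj⟩‖ ≤ ‖cH ⟨e, jj⟩‖ := by
    intro e jj
    have h := hmemc x₁ (hsub (Pset.thetaRegion3_subset_sUnion (Setting.labelSucc i) (.inr pp) hx₁3)) e jj
    simp only [hx₁, AlgEquiv.apply_symm_apply] at h
    exact h
  -- the image point: the radii on the diagonal summand are `≥ ρ`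
  have himg : Φ (Setting.labelSucc i) (.inr pp) '' Pset.thetaRegion3 (Setting.labelSucc i) (.inr pp) ∈
      Pset.possibleImages (Setting.labelSucc i) (.inr pp) := ⟨Φ, hΦind, rfl⟩
  have hcρ : ∀ jj : DIdx (pp : ℕ) ((presAt X hlog pp).kk e₀), ρ ≤ ‖cH ⟨e₀, jj⟩‖ := by
    intro jj
    have hΦx : Φ (Setting.labelSucc i) (.inr pp) x ∈ ⋃₀ Pset.possibleImages (Setting.labelSucc i) (.inr pp) :=
      Set.subset_sUnion_of_mem himg (Set.mem_image_of_mem _ hx3)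
    have h := hmemc _ (hsub hΦx) e₀ jj
    simp only [hcomp x, hx, Pi.single_eq_same, hnorm_gw] at h
    exact h
  -- §2e: the two volumes in the probability-weighted container
  unfold Setting.thetaLocal
  rw [if_pos hHD, hEq, h3, WithTop.coe_le_coe]
  have hvol := (presAtPr X hlog pp).sum_w_packetLogμ_factorMap_preimage_hullSet (Setting.labelSucc i) cH hcH0
  have hvol₀ := (presAtPr X hlog pp).sum_w_packetLogμ_factorMap_preimage_hullSet (Setting.labelSucc i) c₀ hc₀ne
  change ((situationPrVol X hlog M archPk archSub Ψ act Mmod region).D n).logvol (Setting.labelSucc i) (.inr pp)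
      ((fun x => (presAtPr X hlog pp).factorMap (Setting.labelSucc i) x) ⁻¹'
        hullSet ((presAtPr X hlog pp).factorField (Setting.labelSucc i)) cH) = _ at hvol
  change ((situationPrVol X hlog M archPk archSub Ψ act Mmod region).D n).logvol (Setting.labelSucc i) (.inr pp)
      ((fun x => (presAtPr X hlog pp).factorMap (Setting.labelSucc i) x) ⁻¹'
        hullSet ((presAtPr X hlog pp).factorField (Setting.labelSucc i)) c₀) = _ at hvol₀
  change ((situationPrVol X hlog M archPk archSub Ψ act Mmod region).D n).logvol (Setting.labelSucc i) (.inr pp)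
      ((fun x => (presAtPr X hlog pp).factorMap (Setting.labelSucc i) x) ⁻¹'
        hullSet ((presAtPr X hlog pp).factorField (Setting.labelSucc i)) c₀) + _ ≤
    ((situationPrVol X hlog M archPk archSub Ψ act Mmod region).D n).logvol (Setting.labelSucc i) (.inr pp)
      ((fun x => (presAtPr X hlog pp).factorMap (Setting.labelSucc i) x) ⁻¹'
        hullSet ((presAtPr X hlog pp).factorField (Setting.labelSucc i)) cH)
  rw [hvol, hvol₀]
  -- termwise `≤` (radii `‖c₀‖ ≤ ‖λ‖`); on the diagonal summand `log ‖λ‖ ≥ log ρ ≥ log ‖c₀‖ + gain`, coefficients summing to `Pr(v,…,v)`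
  have hcoef : ∀ (e : (presAtPr X hlog pp).toLocalPieces.E (Setting.labelSucc i))
      (jj : DIdx (pp : ℕ) ((presAtPr X hlog pp).kk e)), 0 < (presAtPr X hlog pp).w (Setting.labelSucc i) e *
        ((packetDegree (pp : ℕ) (DFac (pp : ℕ) ((presAtPr X hlog pp).kk e)) : ℝ)⁻¹ *
          ((absRamificationIdx (pp : ℕ) (DFac (pp : ℕ) ((presAtPr X hlog pp).kk e) jj) : ℝ) *
            (residueDegree (pp : ℕ) (DFac (pp : ℕ) ((presAtPr X hlog pp).kk e) jj) : ℝ))) :=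
    fun e jj => mul_pos (weightPr_pos X pp.1 _ e) (mul_pos (inv_pos.mpr (by exact_mod_cast packetDegree_pos _ _))
      (mul_pos (by exact_mod_cast absRamificationIdx_pos _ _) (by exact_mod_cast residueDegree_pos _ _)))
  have hle : ∀ (e : (presAtPr X hlog pp).toLocalPieces.E (Setting.labelSucc i))
      (jj : DIdx (pp : ℕ) ((presAtPr X hlog pp).kk e)), Real.log ‖c₀ ⟨e, jj⟩‖ ≤ Real.log ‖cH ⟨e, jj⟩‖ :=
    fun e jj => Real.log_le_log (norm_pos_iff.mpr (hc₀ne ⟨e, jj⟩)) (hc1 e jj)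
  -- the coefficients on the diagonal summand sum to `Pr(v,…,v)` (`Σ_j e_j f_j = deg`)
  have hsum_coef : ∑ jj : DIdx (pp : ℕ) ((presAtPr X hlog pp).kk e₀), (presAtPr X hlog pp).w (Setting.labelSucc i) e₀ *
        ((packetDegree (pp : ℕ) (DFac (pp : ℕ) ((presAtPr X hlog pp).kk e₀)) : ℝ)⁻¹ *
          ((absRamificationIdx (pp : ℕ) (DFac (pp : ℕ) ((presAtPr X hlog pp).kk e₀) jj) : ℝ) *
            (residueDegree (pp : ℕ) (DFac (pp : ℕ) ((presAtPr X hlog pp).kk e₀) jj) : ℝ))) =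
      weightPr X pp.1 (Setting.labelSucc i) e₀ := by
    rw [← Finset.mul_sum, ← Finset.mul_sum]
    have hdeg : ∑ jj : DIdx (pp : ℕ) ((presAtPr X hlog pp).kk e₀),
        (absRamificationIdx (pp : ℕ) (DFac (pp : ℕ) ((presAtPr X hlog pp).kk e₀) jj) : ℝ) *
          (residueDegree (pp : ℕ) (DFac (pp : ℕ) ((presAtPr X hlog pp).kk e₀) jj) : ℝ) =
        (packetDegree (pp : ℕ) (DFac (pp : ℕ) ((presAtPr X hlog pp).kk e₀)) : ℝ) := by
      unfold packetDegree
      push_cast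
      rfl
    rw [hdeg, inv_mul_cancel₀ (by exact_mod_cast (packetDegree_pos _ _).ne'), mul_one]
    rfl
  -- the diagonal summand: termwise `log ‖λ‖ ≥ log ‖c₀‖ + gain`
  have hdiag : ∀ jj : DIdx (pp : ℕ) ((presAtPr X hlog pp).kk e₀),
      Real.log ‖c₀ ⟨e₀, jj⟩‖ + (((i : ℕ) : ℝ) + 1) * ((e : ℝ) - 1) / (e : ℝ) * Real.log (pp : ℕ) ≤ Real.log ‖cH ⟨e₀, jj⟩‖ := by
    intro jj
    rw [hc₀norm e₀ jj]
    exact hgain.trans (Real.log_le_log hρ_pos (hcρ jj))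
  have he₀mem : e₀ ∈ (Finset.univ : Finset ((presAtPr X hlog pp).toLocalPieces.E (Setting.labelSucc i))) :=
    @Finset.mem_univ _ ((presAtPr X hlog pp).toLocalPieces.instFintype (Setting.labelSucc i)) e₀
  -- the diagonal summand: `A(e₀) + Pr(v,…,v)·gain ≤ C(e₀)`
  have hfinal : ∑ jj : DIdx (pp : ℕ) ((presAtPr X hlog pp).kk e₀), (presAtPr X hlog pp).w (Setting.labelSucc i) e₀ *
          ((packetDegree (pp : ℕ) (DFac (pp : ℕ) ((presAtPr X hlog pp).kk e₀)) : ℝ)⁻¹ *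
            ((absRamificationIdx (pp : ℕ) (DFac (pp : ℕ) ((presAtPr X hlog pp).kk e₀) jj) : ℝ) *
              (residueDegree (pp : ℕ) (DFac (pp : ℕ) ((presAtPr X hlog pp).kk e₀) jj) : ℝ))) * Real.log ‖c₀ ⟨e₀, jj⟩‖ +
        weightPr X pp.1 (Setting.labelSucc i) e₀ * ((((i : ℕ) : ℝ) + 1) * ((e : ℝ) - 1) / (e : ℝ) * Real.log (pp : ℕ)) ≤
      ∑ jj : DIdx (pp : ℕ) ((presAtPr X hlog pp).kk e₀), (presAtPr X hlog pp).w (Setting.labelSucc i) e₀ *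
          ((packetDegree (pp : ℕ) (DFac (pp : ℕ) ((presAtPr X hlog pp).kk e₀)) : ℝ)⁻¹ *
            ((absRamificationIdx (pp : ℕ) (DFac (pp : ℕ) ((presAtPr X hlog pp).kk e₀) jj) : ℝ) *
              (residueDegree (pp : ℕ) (DFac (pp : ℕ) ((presAtPr X hlog pp).kk e₀) jj) : ℝ))) * Real.log ‖cH ⟨e₀, jj⟩‖ := by
    rw [← hsum_coef, Finset.sum_mul, ← Finset.sum_add_distrib]
    refine Finset.sum_le_sum fun jj _ => ?_
    rw [← mul_add]
    exact mul_le_mul_of_nonneg_left (hdiag jj) (hcoef e₀ jj).le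
  -- assemble: termwise `≤` off the diagonal summand (radii `‖c₀‖ ≤ ‖λ‖`), the gain on it
  exact sum_add_le_sum_of_le_of_add_le he₀mem
    (fun e _ => Finset.sum_le_sum fun jj _ => mul_le_mul_of_nonneg_left (hle e jj) (hcoef e jj).le) hfinal

end TestATS4HullGain

end Summit.ABC.IUTFork.Joshi

end
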